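import Summits.QuantumFields.YangMills.Theorems.UnitScaleTiltProp7ChartRemainderRowsPsi
import HarnessLib

/-!
# Prop 7, route-R E′, (E1-c) F4l — `N(0) = 0` (the `hN0` row of ✓p667460) and the skewness letter `(c•ψ)* = −c•ψ` for Hermitian `ψ`, `c̄ = −c`

Route `UnitScaleTilt`, crux K1 child «MinimiserStabilityRegPr» (`stmt-QuantumFields-19200`), cell ym3-torus, width seat px15 (gen 2); pen «px15 g2: (E1-c) GO-LOCATE» (★p1 g15,
2026-08-28T20:45:05Z), LOCATE `LOCATE-E1C-DIVLIPSCHITZ-px15g2.md` §7 (bookkeeping items (iii) and skewness).  THEOREMS ONLY (0 `def`, 0 `sorry`); `--supports stmt-QuantumFields-19200`,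
count-neutral.  YM₃ on T³ is a ladder rung (R3), not the Clay problem; nothing here claims the stub, the crux, d = 4 or the mass gap.

WHAT (F1's abstract lattice letters over `M_N(ℂ)`): ★ `chartRemainder_zero` — at `ψ = 0` the chart remainder `N(ψ)(μ,y) = log(u(y)·E·(R(U)u(Ty))*) − log E + c•D_μψ(y)` vanishes
identically (`u = e^0 = 1`, `R(U)1 = 1`); `star_smul_of_hermitian` — `(c•ψ)* = −c•ψ` when `ψ* = ψ` and `c̄ = −c` (e.g. `c = ±I`: `star_I'`), the skewness hypothesis of F4f–F4j.
HONEST SCOPE.  Bookkeeping ([folklore]).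

References: T. Bałaban, CMP 98 (1985) 17–51 [Balaban1985Averaging] ((19)–(21) p.21); [folklore].
-/

set_option autoImplicit false

noncomputable section

open scoped BigOperators Matrix.Norms.L2Operator Matrix
open NormedSpace

namespace Summit.QuantumFields.YangMills.Theorems.Prop7ChartRemainderZero

open Literature.MathematicalPhysics.QuantumFieldTheory.Balaban1983to89
open MatrixLog (mlog)
open B9Eq39Adjoint (R covD)

variable {n : Type*} [Fintype n] [DecidableEq n] [Nonempty n]
variable {S : Type*} {ι : Type*} (T : ι → Equiv.Perm S) (U : ι → S → (Matrix n n ℂ)ˣ)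

omit [Nonempty n] in
/-- ★ **`N(0) = 0`**: the chart remainder vanishes at `ψ = 0`. [cite: Balaban1985Averaging, (19)-(21) p.21] -/
theorem chartRemainder_zero (c : ℂ) (En : ι → S → Matrix n n ℂ) (μ : ι) (y : S) :
    mlog (exp (c • (fun _ : S => (0 : Matrix n n ℂ)) y) * En μ y * star (R (U μ y) (exp (c • (fun _ : S => (0 : Matrix n n ℂ)) (T μ y)))))
      - mlog (En μ y) + c • covD T U μ (fun _ : S => (0 : Matrix n n ℂ)) y = 0 := by
  simp only [smul_zero, exp_zero, covD, R, mul_one, Units.mul_inv, star_one, one_mul, mul_zero, zero_mul, sub_self, zero_add]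

omit [Fintype n] [DecidableEq n] [Nonempty n] in
/-- `(c•ψ)* = −c•ψ` for `ψ* = ψ` and `c̄ = −c`. [folklore] -/
theorem star_smul_of_hermitian {c : ℂ} (hc : star c = -c) {ψ : Matrix n n ℂ} (hψ : star ψ = ψ) : star (c • ψ) = -(c • ψ) := by
  rw [star_smul, hc, hψ, neg_smul]

/-- `Ī = −I`. (bookkeeping) [folklore] -/
theorem star_I' : star Complex.I = -Complex.I := Complex.conj_I

/-- `(−I)̄ = I = −(−I)`. (bookkeeping) [folklore] -/
theorem star_neg_I' : star (-Complex.I) = -(-Complex.I) := by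
  rw [star_neg, star_I', neg_neg]

/-- `‖±I‖ ≤ 1`. (bookkeeping) [folklore] -/
theorem norm_I_le_one : ‖Complex.I‖ ≤ 1 ∧ ‖-Complex.I‖ ≤ 1 := by
  rw [norm_neg, Complex.norm_I]; exact ⟨le_rfl, le_rfl⟩

end Summit.QuantumFields.YangMills.Theorems.Prop7ChartRemainderZero

end
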